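import Literature.AlgebraicGeometry.AbelianSchemes.PolarizedLevelPushforwardDetClass        -- ★ EDITION 2 ((M2b) ED. 2 v3 1ac0dee4, p792358): `markedSection`, `def SiegelFramedCovariant.PL`
import Literature.AlgebraicGeometry.ModuliOfAbelianVarieties.SiegelFramedCovariantUnique      -- ★ P0 (B-p11 (g19) 00aac88b, filed by B-p10 (g14), p792748): `pl_of_exists_pl`
import Literature.AlgebraicGeometry.ModuliOfAbelianVarieties.SiegelFramedCovariantOfHilb      -- ★ R-C2 (B-p18, v3plusS4 ad953093, p791836): (A) `exists_siegelFramedCovariant_of_hilbertBase`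
import Literature.AlgebraicGeometry.ModuliOfAbelianVarieties.SiegelFramedCovariantOfHilbPrint -- R-C2′ (A′) `exists_siegelFramedCovariant_of_hilbertBase'` over hII″∕hF3′ ((β)+(γ) edition set row 3); ★ p795526 (B-p20 (g15) bytes 5b54e083, filed by B-p18 (g21))
import Literature.AlgebraicGeometry.AbelianSchemes.MFKSubfunctorOfHilbIntrinsic             -- ★ `isBaseChangeVia_id_of_iso_of_one_comp` (hF3 ⇒ hF3′ on the trivial cover)
import Literature.AlgebraicGeometry.ModuliOfAbelianVarieties.SiegelFramedCovariantPlucker   -- ★ (B) P4 FILE B (B-p11 (g20), p793571): `SiegelFramedCovariant.pl_of_hilbertBase`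
import Literature.AlgebraicGeometry.ModuliOfAbelianVarieties.SiegelLinearRigidificationFrameClasses  -- ★ P3 file (B-p11 (g20) 12229134, p790778): `IsLinearRigidification.frameClasses`
import Literature.AlgebraicGeometry.ModuliOfAbelianVarieties.SiegelHilbertBaseWithSections    -- ★ R-C1 `exists_hilbertBase_with_sections`
import Literature.AlgebraicGeometry.Motives.HilbertImagePluckerClass                         -- ★ P2b file (B-p11 (g20) 38e8b5b0, p791887; §0–§1 = B-p03 (g19) seed 577e9800): `hilbertPluckerClass`
import Literature.AlgebraicGeometry.Motives.HilbertImageInGrassmannianUniversalFamily        -- ★ F-5 ⑦b ED. 4 (carriers of `stub_PLhilbClass`)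
import Literature.AlgebraicGeometry.Motives.GrassmannianUniversalChartData                   -- ★ `universalQuotient`
import Literature.AlgebraicGeometry.Modules.SerreTwistTrivial                                 -- ★ `SerreTwist.isFiniteLocallyFree_serreTwist`
import HarnessLib

/-!
# Floor-0 line P1, SUB-LINE `F13PluckerProducer` — skeleton v2.0 = the Q7 EDITION (registry v5.7 (Q7: `stub_II` := `∀ g` + hII″ — director g14 s389 order of record Q-PL v5.6 ✓ → row 4 ★ p796022 → row 11 ★ p796000 → Q7; ask F0P1a-plan (g2) 23:40:37Z): `stub_II` := hII″) for the core `stub_PL` (= the Plücker letter `hPL` of ★ F-12-of-cores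
# ED. 2, [MumfordFogartyKirwan1994] Ch. 7 §2 Prop. 7.4 in intrinsic-class form) — crux `HDel`, item stmt-HodgeConjecture-24835; programme HC_CM FLOOR 0

HC_CM is proved only modulo the 7 printed citations until rung 0 closes; nothing in this file is about HC.  Cell `hodgecm-mathlib`
(D-0151 ∕ D-0183); typed by F0-typ2 (g0) on B-plan1 (g19)'s F-13 SKELETON RULING 20:50:06Z (shape (β′) HEAD-OF-CORES) over the card
`F0/P1/Lines/F13PluckerProducer.md` c89f5782 (B-plan1 v1), B-p10 (g13)'s census `B-provers/B-p10/g13/CENSUS-F13-PluckerPL.B-p10g13.md` §§0–6,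
B-p07 (g19)'s P3 census-lite eb1d4203, B-p03 (g19)'s P2b §0 seed 577e9800, B-p11 (g19)'s P0 seed 00aac88b, B-p18 (g20)'s R-C2 banked
v3plusS4, and my junction memo `F0/P1/F13-SKELETON-PROPOSAL.v0.F0-typ2g0.md` 297b94c3 (J-F13-1 ∕ J-F13-2).  HOME-only workfile
`F0/P1/Lines/F13PluckerProducer.lean`; registration is the registrar's (`ledger crux write stmt-HodgeConjecture-24835 Lines/F13PluckerProducer.lean|.md`).
No `def`, no `instance`, no `notation`, no `axiom`.  EDITIONS: v0 7ea91a98 (boxed GREEN, B-typ01 (g17) 21:07:36Z; sorries 3) → v0.1 974c09ad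
(`stub_PLunitCocycle` PROVED over B-p11 (g20)'s ★-pending `SiegelLinearRigidificationFrameClasses` rf 12229134; sorries 2) → **v1 (this file)**:
(a) `stub_PLhilbClass` PROVED over B-p11's ★-pending `Motives/HilbertImagePluckerClass` rf 6bbf0b3a (`:= hilbertPluckerClass`; statement byte-identical);
(b) `stub_PLofHilbertBase` RE-LETTERED (the ONE re-letter of J-F13-2, required by J-F13-3, TYPE-REQ F0P1d-plan (g0) 21:37:04Z): the raw base
`(H₀, Z₀, f₀, p₀, i₀, τ₀)` is now ★ R-C1 ED. 2 §3's EXPLICIT `powOver` model over `(H₁, Z_H, i_H)` at `S := Spec ℚ` (terms spelled as there), the abstract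
`hunivS` binder is gone (it is the ★ theorem `hilbertBase_with_sections_explicit`), `[LocallyOfFiniteType (terminal.from H₁)]` added; head∕P2b∕P3 letters
byte-identical to v0; the composition feeds R-C2 (A) with the explicit terms and the §3.1 instance facts (v1: sorries 1) → v1.1 f8c085de, J-F13-4
(B-p11 (g20) 21:42:08Z ∕ F0P1d-plan ruling 21:42:30Z, cheap form): ONE conjunct «`regularityBound … − 1 ≤ d`» added to `stub_PLhilbClass`'s `∃`-block and
the matching hypothesis to `stub_PLofHilbertBase` (after `1 ≤ d`); head: one more name in the `obtain`, one more argument; `stub_PLhilbClass` is `sorry`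
again ONLY until B-p11 re-proves `hilbertPluckerClass` with the conjunct (v1.1: sorries 2) → v1.2 868f33cd (`stub_PLhilbClass` BY NAME again over B-p11 (g20)'s
rf v2 38e8b5b0; sorries 1; B-typ01 FULL BOX GREEN 21:53:49Z; F0P1d-plan CO-SIGN 21:57:36Z = skeleton of record) → v1.3 9cbb80ee = the BY-IMPORT
EDITION (all nine `Literature` imports ★: (M2b) ED. 2 p792358 · R-C2 p791836 · P3 p790778 · P2b p791887 · P0 p792748; import tails only; sorries 1) →
**v1.4 (this file) = the FOLD EDITION**: `stub_PLofHilbertBase` PROVED BY NAME over B-p11 (g20)'s ★ `SiegelFramedCovariant.pl_of_hilbertBase`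
(p793571, module `SiegelFramedCovariantPlucker`; the v1.2 letter token for token) + its `import`; all four letters (head, P2b, P3, P4) byte-identical
to v1.1–v1.3 (FROZEN, F0P1d-plan 21:49:54Z).  sorries (v1.4) = ∅ — `stub_PL_of_cores` is CLOSED: `--axioms` = {propext, Classical.choice, Quot.sound}.
→ **v2.0 (this file) = the Q7 EDITION** (F-4 lead B-p17 (g15) memo `EDITION-SET-beta-gamma` row 11; registry card v5.7 (Q7: `stub_II` := `∀ g` + hII″ — director g14 s389 order of record Q-PL v5.6 ✓ → row 4 ★ p796022 → row 11 ★ p796000 → Q7; ask F0P1a-plan (g2) 23:40:37Z)): the head's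
binder `hII` becomes the SERVED letter `stub_II` := `∀ (g : ℕ)` + hII″ = the statement of tree `…Cruxes.HypDel.F4LinearRigidificationII.stub_IIrep'`
([MumfordFogartyKirwan1994] Prop. 6.16 ∕ Thm. 6.14 representability half for PROJECTIVE `p₁`; `(_ : IsProjective p₁)` inserted after `[GeometricallyConnected p₁]`,
the `(_ : IsClosed (Set.range j₂))` conjunct DROPPED (γ)); `hF3` and the conclusion `stub_PL` UNCHANGED; the composition now calls R-C2′ (A′)
`exists_siegelFramedCovariant_of_hilbertBase'` (Print file, row 3) with `(hII g)` and with hF3′ («projective ⇒ dual pair», [MFK94] Ch. 0 §5 (d) +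
Cor. 6.8 verbatim) DERIVED from the registry `hF3` on the trivial Zariski cover (★ `isBaseChangeVia_id_of_iso_of_one_comp`, 3 lines; no new
mathematics); the three stub letters P2b∕P3∕P4 and their by-name bodies byte-identical to v1.4.  sorries (v2.0) = ∅.

## TARGET (JUNCTION J-F13-1, accepted 20:50:06Z)

The registry letter `stub_PL` (`Cruxes/HDel/Lines/F1ExtHodgeType.lean` v5.5-C, `reg55C/stubs-ed2-byname2/4_stub_PL.lean`, digest PL ac053021)
is (T1): «every `𝓗 : SiegelFramedCovariant g N δ J` locally of finite type over `ℚ` (`N ≥ 3`, `#J + 1 = 6^g·d`) satisfies ★ `SiegelFramedCovariant.PL`».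
Its only road is P0 (`pl_of_exists_pl : (∃ 𝓗₀, 𝓗₀.PL) → ∀ 𝓗, 𝓗.PL`) + PL of ONE produced covariant `𝓗₀`, and the producer R-C2 (A)
`exists_siegelFramedCovariant_of_hilbertBase` BINDS the cores `hII` ([MFK94] Thm. 6.14 = registry `stub_II`) and `hF3` (Cor. 6.8 = registry
`stub_F3`): no cores-free `𝓗₀` exists (a covariant IMMERSED in the Hilbert base is Prop. 7.3, whose step (II) is Thm. 6.14).  Hence the head
of this line is the THREE-LETTERS-VERBATIM form

  `theorem stub_PL_of_cores (hII : ‹registry stub_II letter›) (hF3 : ‹registry stub_F3 letter›) : ‹registry stub_PL letter›`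

(the binder letters and the conclusion are the registry letters token for token, so REF1's device reads three digests: II, F3, PL), and the
P1 HEAD file `F0/P1/Lines/SiegelModuliExists.lean` takes the one-line edition
`exists_threshold_siegelFineModuliScheme_of_cores' stub_II stub_F3 (stub_PL_of_cores stub_II stub_F3) stub_F11`.

## THESIS ∕ WHY THIS CUT ([MFK94] Prop. 7.4 p. 135 + Ch. 0 §5 (c) ∕ FGA 221, in the intrinsic Čech-class form of B-p10's memo §1 (c1)–(c5))

`PL 𝓗` asks for an immersion `ι_H : H → 𝐏^r_ℚ` over the structure map, `H` quasi-compact, with `[ι_H^*𝒪(m)]` (some `m > 0`) an INTEGER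
combination of the intrinsic classes `[det π_*(L^Δ(λ)^{⊗k})]` and `[σₐ^* L^Δ(λ)]` in `CechPic H`.  Print's `ι_H` is
`Segre ∘ (Plücker ∘ j ∘ (H ↪ H₀ → H₁), the 2g+1 marked points σₐ ≫ emb)`; its class is computed factor by factor:
* `stub_PLhilbClass` (P2b, HARDEST-but-seeded) — the HILBERT–PLÜCKER CLASS: the closed Hilbert scheme `H₁` of `𝐏^J` with its Grassmannian
  immersion `j : H₁ ↪ Gr_k(ℤ^{(Mon_d)})` (★ F-5 ⑦b ED. 4 `exists_grassmannianImmersion_universal_flat_family`, replayed by B-p03's §0 seed with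
  «`j` classifies `Z_H`») AND the class identity `[j^* 𝒬_k] = [det p_* 𝒪_{Z_H}(d)]` (FGA 221 §4: `j` is the Grassmannian point of the quotient
  `𝒪 ⊗ Sym^d ↠ p_*𝒪_Z(d)`; ★ `exists_iso_pullback_universalQuotient`).  Lettered as ONE existential statement = ⑦b's conclusion ∧ `1 ≤ d`-type
  bookkeeping ∧ the class identity, generic in `(ι, P, e₁, R)`, so that the composition consumes it IN PLACE OF ★ ⑦b and hands its data to P4.
* `stub_PLunitCocycle` (P3) — the FRAME CLASSES of ANY linear rigidification `ι` of ANY triple `P∕T` ([MFK94] Def. 7.5 ∕ Prop. 7.6; B-p10 (c1)–(c3),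
  B-p07 sockets S1–S3) in the U-FREE, SIGN-FREE form the consumer needs: after raising to the power `m + 1 = #J + 1 = rk π_*L^Δ(λ)^{⊗3}` the unit
  cocycle `[U]` of the local frames is ELIMINATED by (c1) `(m+1)[U] = [det π_*L^Δ(λ)^{⊗3}]`, so (c2′) `[(σₐ ≫ ι)^*𝒪(-1)]^{m+1}` and (c3′)
  `[det π_*𝒪_X(d)]^{m+1}` (`𝒪_X(d) := twistMod ι 𝒪_X d`, the POSITIVE twist — `π_*` of a negative twist vanishes) are products of INTEGER powers of
  `[σₐ^*L^Δ(λ)]`, `[det π_*L^Δ(λ)^{⊗3d}]`, `[det π_*L^Δ(λ)^{⊗3}]`.  Exponents are existential (memo risk R4 «sign of `serreTwist = 𝒪(−m)`» cannot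
  bite; PL itself quantifies its exponents existentially); no `CompactSpace T` premise (own `IsFiniteLocallyFree` witnesses, so the composition
  can apply it to the produced covariant whose quasi-compactness is P4's business); sharper forms WITH `[U] = CechPic.mk u` are the P3 hand's
  internal lemmas (census S0–S3, LACK-A∕B∕C), not registered letters.
* `stub_PLofHilbertBase` (P4) — the ASSEMBLY for the covariant PRODUCED by R-C2 (A) over ★ R-C1's Hilbert base: from P2b's data and class,
  P3's two class families at `(𝓗.univ, 𝓗.emb)`, and R-C2 (A)'s exports (`jH : H ↪ H₀` immersion, `prH` cartesian, `emb = prH ≫ i₀ ≫ pr₂`,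
  sections `= jH ≫ τ₀`) conclude `𝓗.PL` — Segre additivity (P1 seed v5 f90d6139, ★-to-be `Modules/SerreTwistSegreClass`), Plücker of the
  Grassmannian with `[θ^*𝒪(-1)] = [det 𝒬_k]⁻¹` (P2a seed 944589c3, `Motives/GrassmannianPluckerToPP`), change of coefficient ring `ℤ → ℚ`, base
  change of `[det p_*𝒪_Z(d)]` from `H₁` to `H`, quasi-compactness of `H`, exponent bookkeeping (twist `m := #J + 1`).
  JUNCTION J-F13-2∕J-F13-3 (v1, settled): v0 lettered the raw base ABSTRACTLY (= R-C2 (A)'s hypotheses); B-p11 (g20)'s `SOCKETS-P4.v0` S1 showed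
  `CompactSpace H` is then reachable only through a Yoneda identification of `H₀` (≈ 150–190 l.), so F0P1d-plan (g0) ruled the ONE allowed re-letter:
  the raw base is ★ R-C1 ED. 2 §3's EXPLICIT `powOver` model (this edition) — the composition already had R-C1's output in hand, so it costs the
  head nothing and gives the P4 prover `H₀ ↪ ∏ 𝐏(J; H₁′)` closed, `Z₀ = Z′ ×_{H₁′} H₀`, Noetherian `H₀`, for free (★ §3.1∕§3.3 lemmas by name).
HEAD PROOF (kernel-checked by paste): `stub_PLhilbClass` at `ι := J`, `P := (6^g d)·X^g`, `e₁ := 1`, `R e := (6e)^g d` → ★ R-C1 ED. 2 §3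
(explicit terms + `hilbertBase_with_sections_explicit` + §3.1 instance facts) at `S := Spec ℚ`, `n := 2g+1` → R-C2 (A) with `hII g`, `hF3` ↦ `(𝓗₀, jH, prH, …)` → `stub_PLunitCocycle` at
`(𝓗₀.univ, 𝓗₀.emb, Gr := (1, λ))` → `stub_PLofHilbertBase` ↦ `𝓗₀.PL` → P0 `pl_of_exists_pl` ↦ `𝓗.PL`.  Not registered, riding as inputs
(BY PASTE in tonight's cert, BY IMPORT at registration, which waits on (M2b) ED. 2 ★ anyway): (M2b) ED. 2 §4–§6, P0, R-C2 (A), B-p11's P3 file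
`SiegelLinearRigidificationFrameClasses` and P2b file `HilbertImagePluckerClass`; and — inside P4's future proof — P1, P2a.

HONEST LABELS.  `hII` inherits the registry's OVER-STRENGTH label (s279 (1b), (α′): `proper` where print has `projective`; repair (β) booked) — it is a
BINDER here, untouched.  The three stubs are [MODULI-STANDARD (GIT) ∕ print-DERIVED]: Prop. 7.4 (p. 135) prints «`H_{g,d,n}` is quasi-projective and
carries a `PGL(m+1)`-linearized ample sheaf» and proves it through `H ↪ (𝐏_m)^{2g+1} × Hilb ↪ … Grassmannian` (Ch. 0 §5 (c), FGA 221); the class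
identities are the intrinsic (`PGL`-invariant) reading of that linearisation (REF1 (g13) m09∕m11, ref2 l23∕l24 reads of record for `PL`), weaker than
B-p10's (c1)–(c4) only by existential exponents.  Barrier: none catalogued applies (moduli-standard).  `lean check`: sorries = ∅ (v1.4);
`--axioms …stub_PL_of_cores` = {propext, Classical.choice, Quot.sound}.
-/

noncomputable section

-- Mathlib's `Over`/pull-back API and `Scheme.Modules` are stated across semireducible wrappers (as in ★ (8α), ★ R-A, R-C2, (M2b)).
set_option backward.isDefEq.respectTransparency false

namespace Summit.HodgeConjecture.CorCM.Cruxes.HypDel.F13PluckerProducer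

open CategoryTheory CategoryTheory.Limits AlgebraicGeometry TopologicalSpace
open Polynomial
open Literature.Algebra.Homology.LaurentCech (regularityBound)
open Literature.AlgebraicGeometry.AbelianSchemes Literature.AlgebraicGeometry.AbelianSchemes.AbelianSchemeOver
  Literature.AlgebraicGeometry.AbelianSchemes.PolarizedAbelianSchemeWithLevel
  Literature.AlgebraicGeometry.Motives Literature.AlgebraicGeometry.Motives.GeneratingSections Literature.AlgebraicGeometry.Motives.Grassmannian
  Literature.AlgebraicGeometry.Modules Literature.AlgebraicGeometry.Modules.SerreTwist
  Literature.AlgebraicGeometry.Morphisms Literature.AlgebraicGeometry.ModuliOfAbelianVarieties Literature.AlgebraicGeometry.RelativeSpec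

/-! ## Stub P2b — the Hilbert scheme of `𝐏(ι)` with its Grassmannian immersion AND the Hilbert–Plücker class -/

/-- **stub (P2b) `stub_PLhilbClass` — `Hilb^P_{𝐏(ι)} ↪ Grass_k(ℤ^{(Mon_d)})` with its universal family, CLOSED, immersion kept, AND the class
identity `[j^*𝒬_k] = [det p_*𝒪_{Z_H}(d)]` in `CechPic H` — PROVED (v1∕v1.2) by B-p11 (g20)'s ★-pending `Literature.AlgebraicGeometry.Motives.hilbertPluckerClass`
(rf v2 38e8b5b0, head in this letter's binder order; §0–§1 = B-p03 (g19)'s seed 577e9800 verbatim); statement byte-identical to v0.**  For `#ι ≥ 1`, a polynomial `P ∈ ℚ[X]`, `e₁`, and values `R e = P(e)` (`e ≥ e₁`): there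
are `d ≥ e₁`, `k`, `e₀ ≥ e₁` (`e₀ > 0`), a locally Noetherian `H` IMMERSED by `j` in the Grassmannian scheme of rank-`k` quotients of `ℤ^{(Mon_d)}`,
a closed `Z_H ⊂ 𝐏(ι; H)` flat over `H` with `p_*𝒪_{Z_H}(e)` locally free of rank `R e` for `e ≥ e₀`, such that (i) the pull-back `j^*𝒬_k` of the
universal quotient and `p_*𝒪_{Z_H}(d)` are finite locally free with THE SAME determinant class ([FGA 221 §4]: `j` is the Grassmannian point of
`𝒪_H ⊗ Sym^d ↠ p_*𝒪_{Z_H}(d)`, so `j^*𝒬_k ≅ p_*𝒪_{Z_H}(d)` — ★ `exists_iso_pullback_universalQuotient` over B-p03 (g19)'s «`j` classifies `Z_H`»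
conjunct, ★ ③b ED. 3 (X1)∕(X3) for `Epi`∕rank at `d`, ★ `detClass_eq_of_iso`), and (ii) `(H, Z_H)` represents the embedded flat families of class
`C(e₀)` on locally Noetherian schemes (★ ⑦b ED. 4 `exists_grassmannianImmersion_universal_flat_family` VERBATIM).  = ★ ⑦b's conclusion ∧ `e₁ ≤ e₀` ∧
`e₁ ≤ d` ∧ «`d ≥ B(P) − 1`» (v1.1, J-F13-4: the REGULARITY INEQUALITY `regularityBound (preHilbertPoly ℚ #ι 0) 0 (preHilbertPoly ℚ #ι 0 − P) − 1 ≤ d`, typed as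
★ ③b `forall_fieldPoint_letters_of_hasRank_twists`'s `hd` binder — print's own hypothesis «`d` ≥ the regularity bound of the Hilbert polynomial», [MFK94]
p. 135 via [Mumford1966CurvesSurface] Lect. 14∕15; it feeds P4's socket S5 = the base-change iso of `p_*𝒪_Z(d)` through ③b (1) `Ext¹ = 0` at `d`) ∧ (i);
proof = B-p03's §0 seed 577e9800 (`…_classified`, replaying ⑦b §6) + P2b proper (B-p10 census row P2b, ≈ 350 l.; B-p11 (g20) rf v2 38e8b5b0 exports it as `hd'`).
Consumed by the COMPOSITION in place of ★ ⑦b (at `ι := J`, `P := (6^g d)·X^g`, `e₁ := 1`, `R e := (6e)^g d`). [MODULI-STANDARD (GIT) ∕ print-DERIVED]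
[cite: MumfordFogartyKirwan1994, Ch. 0 §5 (c) (p. 23); Ch. 7 §2 Proposition 7.4 (p. 135)] [cite: Mumford1966CurvesSurface, Lecture 15 (III.)–(V.) (pp. 106–108)]
[cite: GortzWedhorn2020, (8.4) (pp. 213–215)] -/
theorem stub_PLhilbClass : ∀ ⦃ι : Type⦄ [Finite ι], 1 ≤ Nat.card ι → ∀ (P : ℚ[X]) (e₁ : ℕ) (R : ℕ → ℕ),
    (∀ e, e₁ ≤ e → (R e : ℚ) = P.eval (e : ℚ)) →
    ∃ (d k e₀ : ℕ) (_ : 0 < e₀) (_ : e₁ ≤ e₀) (_ : e₁ ≤ d)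
      (_ : regularityBound (preHilbertPoly ℚ (Nat.card ι) 0) 0 (preHilbertPoly ℚ (Nat.card ι) 0 - P) - 1 ≤ (d : ℤ))
      (_ : (grassmannianSheaf ((Fin d → Fin (Nat.card ι + 1)) →₀ ℤ) k).obj.IsRepresentable)
      (H : Scheme.{0}) (j : H ⟶ grassmannianScheme ((Fin d → Fin (Nat.card ι + 1)) →₀ ℤ) k) (_ : IsImmersion j)
      (_ : IsLocallyNoetherian H) (ZH : Scheme.{0}) (iH : ZH ⟶ projectiveSpace ι H) (_ : IsClosedImmersion iH),
      (Flat (iH ≫ projectiveSpaceFst ι H) ∧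
        ∀ e, e₀ ≤ e → HasRank ((Scheme.Modules.pushforward (iH ≫ projectiveSpaceFst ι H)).obj
          (SerreTwist.twistMod (iH ≫ pullback.snd (terminal.from H) (terminal.from (projectiveSpaceInt ι))) (unitModule ZH) e)) (R e)) ∧
      (∃ (hQ : IsFiniteLocallyFree ((Scheme.Modules.pullback j).obj
            (universalQuotient k ((Fin d → Fin (Nat.card ι + 1)) →₀ ℤ)
              (Finsupp.basisSingleOne : Module.Basis (Fin d → Fin (Nat.card ι + 1)) ℤ _))))
          (hP : IsFiniteLocallyFree ((Scheme.Modules.pushforward (iH ≫ projectiveSpaceFst ι H)).obj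
            (SerreTwist.twistMod (iH ≫ pullback.snd (terminal.from H) (terminal.from (projectiveSpaceInt ι))) (unitModule ZH) d))),
          detClass hQ = detClass hP) ∧
      ∀ ⦃T : Scheme.{0}⦄ [IsLocallyNoetherian T] ⦃Z : Scheme.{0}⦄ (i : Z ⟶ projectiveSpace ι T)
        [IsClosedImmersion i] [Flat (i ≫ projectiveSpaceFst ι T)],
        (∀ e, e₀ ≤ e → HasRank ((Scheme.Modules.pushforward (i ≫ projectiveSpaceFst ι T)).obj
          (SerreTwist.twistMod (i ≫ pullback.snd (terminal.from T) (terminal.from (projectiveSpaceInt ι))) (unitModule Z) e)) (R e)) →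
        ∃! v : T ⟶ H, ∃ e : Z ⟶ ZH, IsPullback e i iH (projectiveSpaceMap ι v) :=
  -- B-p11 (g20) rf v2 38e8b5b0: B-p03 (g19)'s §0 replay of ⑦b with «`j` classifies `Z_H`» + `j^*𝒬_k ≅ p_*𝒪_{Z_H}(d)` (★ `exists_iso_pullback_universalQuotient`),
  -- the regularity inequality exported as its `hd'` (J-F13-4)
  Literature.AlgebraicGeometry.Motives.hilbertPluckerClass

/-! ## Stub P3 — the frame classes of a linear rigidification, `[U]`-free -/

/-- **stub (P3) `stub_PLunitCocycle` — the FRAME CLASSES of a linear rigidification, `(m+1)`-th powers, `[U]` eliminated — PROVED (v0.1) by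
B-p11 (g20)'s ★-pending `PolarizedAbelianSchemeWithLevel.IsLinearRigidification.frameClasses` (the same letter for an arbitrary section `σ` of `π`,
specialised here to the `2g+1` marked sections; road: clause (V) of Prop. 7.3 ★ R-B2a + «`π_*𝒪_X(1)` is free on the coordinate sections» +
projection formula — no explicit cocycle); statement byte-identical to v0.**  For a triple
`P = (X∕T, λ, σ)` over a locally Noetherian `ℚ`-scheme `T`, a linear rigidification `ι : X → 𝐏^J_ℤ` of `P` ([MFK94] Def. 7.5: Zariski-locally on
`T` the morphism of a frame of `π_*L^Δ(λ)^{⊗3}`, `m + 1 := #J + 1 = 6^g·d` its rank — Prop. 6.13) and the graph datum `Gr = (1, λ)` (`L^Δ(λ) =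
Gr^*𝒫`): (c2′) for each of the `2g+1` marked sections `σₐ` (★ `markedSection`), the class of `(σₐ ≫ ι)^*𝒪(-1)` (★ `serreTwist _ 1`) satisfies
`[(σₐ ≫ ι)^*𝒪(-1)]^{m+1} = [σₐ^*L^Δ(λ)]^{e₁} · [det π_*L^Δ(λ)^{⊗3}]^{e₂}` for some integers `e₁ e₂`; (c3′) for every `d > 0`, `π_*𝒪_X(d)` (`𝒪_X(d) :=
twistMod ι 𝒪_X d`, Zariski-locally `≅ L^Δ(λ)^{⊗3d} ⊗ π^*U^{⊗d}`) is finite locally free and `[det π_*𝒪_X(d)]^{m+1} = [det π_*L^Δ(λ)^{⊗3d}]^{e₁} ·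
[det π_*L^Δ(λ)^{⊗3}]^{e₂}` for some integers.  MECHANISM (B-p10 memo §1, B-p07 census S0–S3): on a frame cover the frames differ by UNITS `u`
(Stein ★ `AbelianSchemeSteinOfNoetherian.baseChange_appTop_bijective` ∕ ★ `ProjFrame.exists_eq_scalar_mul_transporterGL`), `[U] := CechPic.mk u`;
(c1) `[det π_*L^{Δ3}] = [U]^{m+1}` (transition `u^{m+1}` of `det e`), (c2) `[(σₐ ≫ ι)^*𝒪(1)] = 3[σₐ^*L^Δ] − [U]`, (c3) `[det π_*𝒪_X(d)] = [det π_*L^{Δ3d}] −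
d·(6d)^g d_δ·[U]`; multiplying by `m+1` and substituting (c1) gives the letter.  Own `IsFiniteLocallyFree` witnesses (no `CompactSpace T`; `detClass`
is witness-independent, ★ `detClass_eq_mk`), so the composition applies it to the produced covariant. [MODULI-STANDARD (GIT) ∕ print-DERIVED]
[cite: MumfordFogartyKirwan1994, Ch. 7 §2 Definition 7.5 (p. 130), Proposition 7.6 (p. 136), Proposition 7.4 (p. 135); Ch. 6 §2 Proposition 6.13 (p. 123)]
[cite: GortzWedhorn2020, (4.14) (pp. 114–115)] -/
theorem stub_PLunitCocycle : ∀ ⦃g N : ℕ⦄ ⦃δ : Fin g → ℕ⦄ ⦃J : Type⦄ [Finite J] ⦃T : Scheme.{0}⦄ [IsLocallyNoetherian T]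
    (_πT : T ⟶ Spec (.of ℚ)) (P : PolarizedAbelianSchemeWithLevel g N δ T) (ι : P.A.X.left ⟶ projectiveSpaceInt J),
    P.IsLinearRigidification J ι → Nat.card J + 1 = 6 ^ g * polarizationDegree δ →
    ∀ (Gr : P.A.X.left ⟶ P.A.prodLeft P.D.hat) (_ : Gr ≫ pullback.fst P.A.X.hom P.D.hat.X.hom = 𝟙 _)
      (_ : Gr ≫ pullback.snd P.A.X.hom P.D.hat.X.hom = P.pol.lam.left),
    (∀ a : Option (Fin g ⊕ Fin g),
      ∃ (h₃ : IsFiniteLocallyFree ((Scheme.Modules.pushforward P.A.X.hom).obj (tensorPow ((Scheme.Modules.pullback Gr).obj P.D.P) 3)))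
        (e₁ e₂ : ℤ),
        detClass (SerreTwist.isFiniteLocallyFree_serreTwist (P.markedSection a ≫ ι) 1) ^ (Nat.card J + 1) =
          detClass (P.isFiniteLocallyFree_markedSectionPullback_LDelta Gr a) ^ e₁ * detClass h₃ ^ e₂) ∧
    (∀ (d : ℕ), 0 < d →
      ∃ (hd : IsFiniteLocallyFree ((Scheme.Modules.pushforward P.A.X.hom).obj (SerreTwist.twistMod ι (unitModule P.A.X.left) d)))
        (h₃d : IsFiniteLocallyFree ((Scheme.Modules.pushforward P.A.X.hom).obj (tensorPow ((Scheme.Modules.pullback Gr).obj P.D.P) (3 * d))))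
        (h₃ : IsFiniteLocallyFree ((Scheme.Modules.pushforward P.A.X.hom).obj (tensorPow ((Scheme.Modules.pullback Gr).obj P.D.P) 3)))
        (e₁ e₂ : ℤ),
        detClass hd ^ (Nat.card J + 1) = detClass h₃d ^ e₁ * detClass h₃ ^ e₂) := by
  intro g N δ J _ T _ πT P ι hι hJ Gr hGr₁ hGr₂
  -- B-p11 (g20): the generic frame classes, at the marked sections (each a section of `π`: the unit, or a level section)
  have h := PolarizedAbelianSchemeWithLevel.IsLinearRigidification.frameClasses πT P ι hι hJ Gr hGr₁ hGr₂
  exact ⟨fun a => h.1 (P.markedSection a)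
      (by cases a with
          | none => exact P.A.unitSection_comp_hom
          | some i => exact Over.w (P.level.σ i))
      (P.isFiniteLocallyFree_markedSectionPullback_LDelta Gr a), h.2⟩

/-! ## Stub P4 — the assembly for the covariant produced over ★ R-C1's EXPLICIT Hilbert base (v1 re-letter, J-F13-2∕J-F13-3) -/

/-- **stub (P4) `stub_PLofHilbertBase` — [MumfordFogartyKirwan1994] Prop. 7.4 (p. 135) for THE PRODUCED COVARIANT: `𝓗.PL` — PROVED (v1.4) BY NAME over
B-p11 (g20)'s ★ `Literature.AlgebraicGeometry.ModuliOfAbelianVarieties.SiegelFramedCovariant.pl_of_hilbertBase` (p793571; letter token for token).**  (v1 RE-LETTER, the one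
allowed by B-plan1's ruling 20:50:06Z on J-F13-2, REQUIRED by J-F13-3 = B-p11 (g20)'s `SOCKETS-P4.v0` S1 «`CompactSpace H` is not derivable from the
abstract binders», ruled by F0P1d-plan (g0) 21:37:04Z.)  Data: the Hilbert-scheme level `(H₁ ↪_j Gr, Z_H ⊂ 𝐏(J; H₁))` ABSTRACT, with its universal
property for the class `C(e₀)` «flat, `p_*𝒪(e)` locally free of rank `(6e)^g d` for `e ≥ e₀`» and the Hilbert–Plücker class `[j^*𝒬_k] = [det p_*𝒪_{Z_H}(d)]`
(= the OUTPUT of `stub_PLhilbClass`); the raw base with `n = 2g+1` sections is ★ R-C1 ED. 2 §3's EXPLICIT model over `(H₁, Z_H, i_H)` at `S := Spec ℚ`,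
spelled with Mathlib `pullback`∕`WidePullback` and ★ `powOver` exactly as there (no binder, no definition): `H₁′ := H₁ ×_ℤ Spec ℚ`, `Z′ := Z_H ×_{𝐏(J;H₁)} 𝐏(J;H₁′)`
(`iH′ := pullback.snd`, `p′ := iH′ ≫ pr₁`), `H₀ := powOver p′ n = (Z′)ⁿ_{H₁′}`, `base := powOver.base p′ n`, `f₀ := base ≫ f₁`, `Z₀ := pullback p′ base`,
`p₀ := pullback.snd p′ base`, `i₀ := pullback.lift p₀ (pullback.fst ≫ iH′ ≫ pr₂) _`, `τ₀ k := pullback.lift (WidePullback.π _ k) (𝟙 H₀) _` — so the prover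
HAS: `hunivS` = ★ `hilbertBase_with_sections_explicit`, `H₀ ↪ ∏_{H₁′} 𝐏(J; H₁′)` closed (★ `isClosedImmersion_hilbertBase_lift_proj`), `Z₀ = Z′ ×_{H₁′} H₀` with
`i₀` the base change of `iH′` (★ `isPullback_hilbertBaseFamily_lift`), `LocallyOfFiniteType f₀` ∕ `IsClosedImmersion i₀` ∕ `Flat p₀` (★ §3.1), hence
`H₀` Noetherian and `H` quasi-compact (S1), the map `H → H₀ → H₁′ → H₁` classifying `Z_H` (S2), and the product-of-projective-spaces point of `H` (S3);
the covariant `𝓗` with R-C2 (A)'s EXPORTS VERBATIM at these terms (`jH : H ↪ H₀` immersion, `H.hom = jH ≫ f₀`, `prH : univ.X → Z₀` cartesian over `jH`,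
`emb = prH ≫ i₀ ≫ pr₂`, unit∕level sections `= jH ≫ τ₀ (eι ·)`, `H → Spec ℚ` l.f.t.); and the two class families of `stub_PLunitCocycle` at
`(𝓗.univ, 𝓗.emb, Gr = (1, λ))`.  Conclusion: ★ `SiegelFramedCovariant.PL 𝓗` — `ι_H := Segre ∘ ((σₐ ≫ emb)ₐ, Plücker ∘ j ∘ v_H) × (H → Spec ℚ)`, `H`
quasi-compact, twist `m := #J + 1`; road = B-p11 (g20) `SOCKETS-P4.v0` S1–S7 (Segre additivity P1 seed f90d6139, `[θ^*𝒪(-1)] = [det 𝒬_k]⁻¹` P2a pair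
4f7e0ef3∕b65ef90d, base change of `[det p_*𝒪_Z(d)]` along the classifying map S5, (c2′)∕(c3′) exponent bookkeeping S6, witness bridges S7); size ≈ 300–380 l.
[MODULI-STANDARD (GIT) ∕ print-DERIVED]
[cite: MumfordFogartyKirwan1994, Ch. 7 §2 Proposition 7.4 (p. 135), Proposition 7.3 (p. 132; proof pp. 132–134), Definition 7.5 (p. 130); §7.2 (*) (p. 131); Ch. 0 §5 (c) (p. 23)]
[cite: MumfordFogartyKirwan1994, Ch. 6 §2 Proposition 6.13 (p. 123)] -/
theorem stub_PLofHilbertBase : ∀ ⦃g N : ℕ⦄ ⦃δ : Fin g → ℕ⦄ ⦃J : Type⦄ [Finite J], 0 < g → IsPolarizationType δ → N ≠ 0 →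
    Nat.card J + 1 = 6 ^ g * polarizationDegree δ →
    -- the Hilbert-scheme level (= the output of `stub_PLhilbClass` at `ι := J`, `P := (6^g d)·X^g`, `R e := (6e)^g d`), incl. `d ≥ B(P) − 1` (J-F13-4 → S5)
    ∀ (d k e₀ : ℕ), 0 < e₀ → 1 ≤ d →
    regularityBound (preHilbertPoly ℚ (Nat.card J) 0) 0
        (preHilbertPoly ℚ (Nat.card J) 0 - Polynomial.C ((6 : ℚ) ^ g * polarizationDegree δ) * Polynomial.X ^ g) - 1 ≤ (d : ℤ) →
    ∀ [(grassmannianSheaf ((Fin d → Fin (Nat.card J + 1)) →₀ ℤ) k).obj.IsRepresentable]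
      ⦃H₁ : Scheme.{0}⦄ (j : H₁ ⟶ grassmannianScheme ((Fin d → Fin (Nat.card J + 1)) →₀ ℤ) k) [IsImmersion j] [IsLocallyNoetherian H₁]
      [LocallyOfFiniteType (terminal.from H₁)]
      ⦃ZH : Scheme.{0}⦄ (iH : ZH ⟶ projectiveSpace J H₁) [IsClosedImmersion iH] [Flat (iH ≫ projectiveSpaceFst J H₁)],
    (∀ e, e₀ ≤ e → HasRank ((Scheme.Modules.pushforward (iH ≫ projectiveSpaceFst J H₁)).obj
      (SerreTwist.twistMod (iH ≫ pullback.snd (terminal.from H₁) (terminal.from (projectiveSpaceInt J))) (unitModule ZH) e))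
      ((6 * e) ^ g * polarizationDegree δ)) →
    ∀ (hQ : IsFiniteLocallyFree ((Scheme.Modules.pullback j).obj
        (universalQuotient k ((Fin d → Fin (Nat.card J + 1)) →₀ ℤ)
          (Finsupp.basisSingleOne : Module.Basis (Fin d → Fin (Nat.card J + 1)) ℤ _))))
      (hP : IsFiniteLocallyFree ((Scheme.Modules.pushforward (iH ≫ projectiveSpaceFst J H₁)).obj
        (SerreTwist.twistMod (iH ≫ pullback.snd (terminal.from H₁) (terminal.from (projectiveSpaceInt J))) (unitModule ZH) d))),
    detClass hQ = detClass hP →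
    (∀ ⦃T : Scheme.{0}⦄ [IsLocallyNoetherian T] ⦃Z : Scheme.{0}⦄ (i : Z ⟶ projectiveSpace J T)
        [IsClosedImmersion i] [Flat (i ≫ projectiveSpaceFst J T)],
        (∀ e, e₀ ≤ e → HasRank ((Scheme.Modules.pushforward (i ≫ projectiveSpaceFst J T)).obj
          (SerreTwist.twistMod (i ≫ pullback.snd (terminal.from T) (terminal.from (projectiveSpaceInt J))) (unitModule Z) e))
          ((6 * e) ^ g * polarizationDegree δ)) →
        ∃! v : T ⟶ H₁, ∃ e : Z ⟶ ZH, IsPullback e i iH (projectiveSpaceMap J v)) →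
    -- the raw base with `n = 2g+1` sections = ★ R-C1 ED. 2 §3's EXPLICIT `powOver` model (terms spelled as there; `hunivS` is the ★ theorem
    -- `hilbertBase_with_sections_explicit`, not a binder), and the produced covariant with R-C2 (A)'s exports VERBATIM at those terms
    ∀ ⦃n : ℕ⦄ (eι : Option (Fin g ⊕ Fin g) ≃ Fin n) (𝓗 : SiegelFramedCovariant g N δ J)
      (jH : 𝓗.H.left ⟶ powOver (pullback.snd iH (projectiveSpaceMap J (pullback.fst (terminal.from H₁) (terminal.from (Spec (.of ℚ))))) ≫ projectiveSpaceFst J (pullback (terminal.from H₁) (terminal.from (Spec (.of ℚ))))) n) [IsImmersion jH]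
      (prH : 𝓗.univ.A.X.left ⟶ pullback (pullback.snd iH (projectiveSpaceMap J (pullback.fst (terminal.from H₁) (terminal.from (Spec (.of ℚ))))) ≫ projectiveSpaceFst J (pullback (terminal.from H₁) (terminal.from (Spec (.of ℚ))))) (powOver.base (pullback.snd iH (projectiveSpaceMap J (pullback.fst (terminal.from H₁) (terminal.from (Spec (.of ℚ))))) ≫ projectiveSpaceFst J (pullback (terminal.from H₁) (terminal.from (Spec (.of ℚ))))) n)),
    𝓗.H.hom = jH ≫ powOver.base (pullback.snd iH (projectiveSpaceMap J (pullback.fst (terminal.from H₁) (terminal.from (Spec (.of ℚ))))) ≫ projectiveSpaceFst J (pullback (terminal.from H₁) (terminal.from (Spec (.of ℚ))))) n ≫ pullback.snd (terminal.from H₁) (terminal.from (Spec (.of ℚ))) →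
    IsPullback prH 𝓗.univ.A.X.hom (pullback.snd (pullback.snd iH (projectiveSpaceMap J (pullback.fst (terminal.from H₁) (terminal.from (Spec (.of ℚ))))) ≫ projectiveSpaceFst J (pullback (terminal.from H₁) (terminal.from (Spec (.of ℚ))))) (powOver.base (pullback.snd iH (projectiveSpaceMap J (pullback.fst (terminal.from H₁) (terminal.from (Spec (.of ℚ))))) ≫ projectiveSpaceFst J (pullback (terminal.from H₁) (terminal.from (Spec (.of ℚ))))) n)) jH →
    𝓗.emb = prH ≫ pullback.lift (pullback.snd (pullback.snd iH (projectiveSpaceMap J (pullback.fst (terminal.from H₁) (terminal.from (Spec (.of ℚ))))) ≫ projectiveSpaceFst J (pullback (terminal.from H₁) (terminal.from (Spec (.of ℚ))))) (powOver.base (pullback.snd iH (projectiveSpaceMap J (pullback.fst (terminal.from H₁) (terminal.from (Spec (.of ℚ))))) ≫ projectiveSpaceFst J (pullback (terminal.from H₁) (terminal.from (Spec (.of ℚ))))) n)) (pullback.fst (pullback.snd iH (projectiveSpaceMap J (pullback.fst (terminal.from H₁) (terminal.from (Spec (.of ℚ))))) ≫ projectiveSpaceFst J (pullback (terminal.from H₁)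 (terminal.from (Spec (.of ℚ))))) (powOver.base (pullback.snd iH (projectiveSpaceMap J (pullback.fst (terminal.from H₁) (terminal.from (Spec (.of ℚ))))) ≫ projectiveSpaceFst J (pullback (terminal.from H₁) (terminal.from (Spec (.of ℚ))))) n) ≫ pullback.snd iH (projectiveSpaceMap J (pullback.fst (terminal.from H₁) (terminal.from (Spec (.of ℚ))))) ≫ pullback.snd (terminal.from (pullback (terminal.from H₁) (terminal.from (Spec (.of ℚ))))) (terminal.from (projectiveSpaceInt J))) (terminal.hom_ext _ _) ≫
      pullback.snd (terminal.from (powOver (pullback.snd iH (projectiveSpaceMap J (pullback.fst (terminal.from H₁) (terminal.from (Spec (.of ℚ))))) ≫ projectiveSpaceFst J (pullback (terminal.from H₁) (terminal.from (Spec (.of ℚ))))) n)) (terminal.from (projectiveSpaceInt J)) →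
    𝓗.univ.A.unitSection ≫ prH = jH ≫ pullback.lift (WidePullback.π (fun _ : Fin n => pullback.snd iH (projectiveSpaceMap J (pullback.fst (terminal.from H₁) (terminal.from (Spec (.of ℚ))))) ≫ projectiveSpaceFst J (pullback (terminal.from H₁) (terminal.from (Spec (.of ℚ))))) (eι none)) (𝟙 (powOver (pullback.snd iH (projectiveSpaceMap J (pullback.fst (terminal.from H₁) (terminal.from (Spec (.of ℚ))))) ≫ projectiveSpaceFst J (pullback (terminal.from H₁) (terminal.from (Spec (.of ℚ))))) n)) (by rw [WidePullback.π_arrow, Category.id_comp]) →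
    (∀ i, (𝓗.univ.level.σ i).left ≫ prH = jH ≫ pullback.lift (WidePullback.π (fun _ : Fin n => pullback.snd iH (projectiveSpaceMap J (pullback.fst (terminal.from H₁) (terminal.from (Spec (.of ℚ))))) ≫ projectiveSpaceFst J (pullback (terminal.from H₁) (terminal.from (Spec (.of ℚ))))) (eι (some i))) (𝟙 (powOver (pullback.snd iH (projectiveSpaceMap J (pullback.fst (terminal.from H₁) (terminal.from (Spec (.of ℚ))))) ≫ projectiveSpaceFst J (pullback (terminal.from H₁) (terminal.from (Spec (.of ℚ))))) n)) (by rw [WidePullback.π_arrow, Category.id_comp])) →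
    LocallyOfFiniteType 𝓗.H.hom →
    -- the frame classes of `(𝓗.univ, 𝓗.emb)` (= the output of `stub_PLunitCocycle`), graph datum `Gr = (1, λ)`
    ∀ (Gr : 𝓗.univ.A.X.left ⟶ 𝓗.univ.A.prodLeft 𝓗.univ.D.hat) (_ : Gr ≫ pullback.fst 𝓗.univ.A.X.hom 𝓗.univ.D.hat.X.hom = 𝟙 _)
      (_ : Gr ≫ pullback.snd 𝓗.univ.A.X.hom 𝓗.univ.D.hat.X.hom = 𝓗.univ.pol.lam.left),
    (∀ a : Option (Fin g ⊕ Fin g),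
      ∃ (h₃ : IsFiniteLocallyFree ((Scheme.Modules.pushforward 𝓗.univ.A.X.hom).obj
          (tensorPow ((Scheme.Modules.pullback Gr).obj 𝓗.univ.D.P) 3))) (e₁ e₂ : ℤ),
        detClass (SerreTwist.isFiniteLocallyFree_serreTwist (𝓗.univ.markedSection a ≫ 𝓗.emb) 1) ^ (Nat.card J + 1) =
          detClass (𝓗.univ.isFiniteLocallyFree_markedSectionPullback_LDelta Gr a) ^ e₁ * detClass h₃ ^ e₂) →
    (∀ (d' : ℕ), 0 < d' →
      ∃ (hd : IsFiniteLocallyFree ((Scheme.Modules.pushforward 𝓗.univ.A.X.hom).obj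
          (SerreTwist.twistMod 𝓗.emb (unitModule 𝓗.univ.A.X.left) d')))
        (h₃d : IsFiniteLocallyFree ((Scheme.Modules.pushforward 𝓗.univ.A.X.hom).obj
          (tensorPow ((Scheme.Modules.pullback Gr).obj 𝓗.univ.D.P) (3 * d'))))
        (h₃ : IsFiniteLocallyFree ((Scheme.Modules.pushforward 𝓗.univ.A.X.hom).obj
          (tensorPow ((Scheme.Modules.pullback Gr).obj 𝓗.univ.D.P) 3))) (e₁ e₂ : ℤ),
        detClass hd ^ (Nat.card J + 1) = detClass h₃d ^ e₁ * detClass h₃ ^ e₂) →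
    𝓗.PL :=
  -- ★ (B) p793571, B-p11 (g20): sockets S1–S8 over ★ FILE A `SiegelHilbertBasePluckerPrelims`, ★ P2a, ★ W3, ★ S5 brick, ★ (B-gen); (B2) `pl_of_immersion_of_frameClasses`
  Literature.AlgebraicGeometry.ModuliOfAbelianVarieties.SiegelFramedCovariant.pl_of_hilbertBase

/-! ## HEAD — `stub_PL` of registry 24835 FROM THE CORES `stub_II` (served letter v5.7 (Q7: `stub_II` := `∀ g` + hII″ — director g14 s389 order of record Q-PL v5.6 ✓ → row 4 ★ p796022 → row 11 ★ p796000 → Q7; ask F0P1a-plan (g2) 23:40:37Z) = hII″ with `∀ g`), `stub_F3` (v5.5-C) (shape (β′), three letters verbatim) -/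

/-- **HEAD `stub_PL_of_cores` — the registry-24835 v5.5-C letter `stub_PL` (digest PL ac053021) PROVED from the registry letters `stub_II`
(digest II f1cd8dcc) and `stub_F3` (F3 343c289e) taken as binders VERBATIM, and the three stubs of this line** (J-F13-1: the producer R-C2 (A)
of the covariant binds the cores; no cores-free covariant exists).  Registry docstring of the conclusion follows: **stub (FACT) CORE PL = the
Plücker letter of the linearly rigidified covariant: every `𝓗 : SiegelFramedCovariant g N δ J` locally of finite type over ℚ (`N ≥ 3`,
`#J + 1 = 6^g·d`) satisfies ★ `SiegelFramedCovariant.PL` — `H` quasi-compact, IMMERSED `ι_H : H → 𝐏^r_ℚ` over its structure map, the class of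
`ι_H^*𝒪(m)` an integer combination of the determinants `[det π_*(L^Δ(λ)^{⊗k})]` and of the section classes `[sec_a^*L^Δ(λ)]` — the binder `hPL`
of ★ F-12-of-cores ED. 2 VERBATIM (the print-located residue of (H-rep) after R2⁺; director g12 s276 (i); REF1 (g13) m09∕m11 + ref2 l23∕l24
≤-print reads of record: EXISTENCE of `ι_H` = Prop. 7.4, the IDENTITY = the intrinsic form of the `PGL(m+1)`-linearisation, print-derived from
§7.2 (*), Def. 7.5, Prop. 6.13 (ii)(iv)).** [MODULI-STANDARD (GIT)].  Binders: `hII` = [MFK94] Thm. 6.14 with the group law as data (registry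
CORE II in its Q7 form hII″: PROJECTIVE `p₁` as printed (repair (β)), no closedness conjunct (γ)), `hF3` = Cor. 6.8 Zariski-locally
(registry CORE F3).  PROOF: `stub_PLhilbClass` → ★ R-C1 → hF3′ from `hF3` → R-C2′ (A′) → `stub_PLunitCocycle` → `stub_PLofHilbertBase` → P0 `pl_of_exists_pl`.
[cite: MumfordFogartyKirwan1994, Ch. 7 §2 Proposition 7.4 (p. 135), §7.2 (*) (p. 131), Definition 7.5 (p. 130), Proposition 7.3 (p. 132)]
[cite: MumfordFogartyKirwan1994, Ch. 6 §2 Proposition 6.13 (ii)(iv) (p. 123)]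
[cite: MumfordFogartyKirwan1994, Ch. 6 §3 Theorem 6.14 (p. 124); Ch. 6 §1 Corollary 6.8 (p. 118)] -/
theorem stub_PL_of_cores
    (hII : ∀ (g : ℕ) ⦃H₁ Z₁ : Scheme.{0}⦄ (p₁ : Z₁ ⟶ H₁) [IsProper p₁] [Smooth p₁] [GeometricallyConnected p₁]
      (_ : IsProjective p₁)
      (f₁ : H₁ ⟶ Spec (.of ℚ)) [LocallyOfFiniteType f₁] (ε₁ : H₁ ⟶ Z₁) (_ : ε₁ ≫ p₁ = 𝟙 H₁),
      ∃ (H₂ : Scheme.{0}) (j₂ : H₂ ⟶ H₁) (_ : IsOpenImmersion j₂)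
      (G : GrpObj (Over.mk (pullback.snd p₁ j₂))),
        (@MonObj.one _ _ _ (Over.mk (pullback.snd p₁ j₂)) G.toMonObj).left ≫ pullback.fst p₁ j₂ = j₂ ≫ ε₁ ∧
        SmoothOfRelativeDimension g (pullback.snd p₁ j₂) ∧
        ∀ ⦃T : Scheme.{0}⦄ (v : T ⟶ H₁),
          (∃! w : T ⟶ H₂, w ≫ j₂ = v) ↔
            ∃ G' : GrpObj (Over.mk (pullback.snd p₁ v)),
              (@MonObj.one _ _ _ (Over.mk (pullback.snd p₁ v)) G'.toMonObj).left ≫ pullback.fst p₁ v = v ≫ ε₁ ∧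
              SmoothOfRelativeDimension g (pullback.snd p₁ v))
    (hF3 : ∀ ⦃S : Scheme.{0}⦄ [IsLocallyNoetherian S] (_fS : S ⟶ Spec (.of ℚ)) (A : AbelianSchemeOver S),
      (∀ s : S, ∃ (U : Scheme.{0}) (i : U ⟶ S) (_ : IsOpenImmersion i) (_ : s ∈ Set.range i.base)
        (B : AbelianSchemeOver U) (G : B.X.left ⟶ A.X.left), B.IsBaseChangeVia A i G ∧ IsProjective B.X.hom) →
      Nonempty A.DualPair) :
    ∀ ⦃g N : ℕ⦄ ⦃δ : Fin g → ℕ⦄ ⦃J : Type⦄ [Finite J], 0 < g → IsPolarizationType δ → 3 ≤ N →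
      Nat.card J + 1 = 6 ^ g * polarizationDegree δ →
      ∀ 𝓗 : SiegelFramedCovariant g N δ J, LocallyOfFiniteType 𝓗.H.hom → 𝓗.PL := by
  intro g N δ J _ hg hδ hN hJ 𝓗 _
  classical
  have hd1 : 1 ≤ polarizationDegree δ := Finset.prod_pos fun i _ ↦ hδ.1 i
  have hn : 1 ≤ Nat.card J := by
    have h6 : 6 ≤ 6 ^ g := by
      calc (6 : ℕ) = 6 ^ 1 := (pow_one 6).symm
        _ ≤ 6 ^ g := Nat.pow_le_pow_right (by norm_num) hg
    have h66 : 6 * 1 ≤ 6 ^ g * polarizationDegree δ := Nat.mul_le_mul h6 hd1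
    omega
  have hN0 : N ≠ 0 := by omega
  -- P2b: the closed Hilbert scheme `Hilb^{(6^g d)X^g}(𝐏^J) ↪ Gr` with its universal family AND the Hilbert–Plücker class
  obtain ⟨d, k, e₀, he₀, -, h1d, hreg, hrep, H₁, j, hj, hH₁, ZH, iH, hiH, ⟨hflat, hrank⟩, ⟨hQ, hP, hQP⟩, huniv⟩ :=
    stub_PLhilbClass hn (Polynomial.C ((6 : ℚ) ^ g * polarizationDegree δ) * Polynomial.X ^ g) 1
      (fun e => (6 * e) ^ g * polarizationDegree δ)
      (fun e _ => by push_cast; simp [Polynomial.eval_mul, Polynomial.eval_pow, Polynomial.eval_C, Polynomial.eval_X, mul_pow]; ring)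
  haveI := hrep
  haveI := hj
  haveI := hiH
  haveI := hflat
  haveI := hH₁
  -- the Hilbert scheme is locally of finite type over `ℤ` (immersion into the Grassmannian, ★ `GrassmannianSchemeProper`)
  haveI : LocallyOfFiniteType (terminal.from H₁) := by
    rw [← terminal.comp_from j]
    haveI := Grassmannian.locallyOfFiniteType_terminal_from ((Fin d → Fin (Nat.card J + 1)) →₀ ℤ) k
    infer_instance
  -- ★ R-C1 ED. 2 §3: the EXPLICIT raw base `H₀ := (Z′)^{(2g+1)}_{H₁′}` with its universal family and tautological sections (instance facts §3.1)
  let eι : Option (Fin g ⊕ Fin g) ≃ Fin (Fintype.card (Option (Fin g ⊕ Fin g))) := Fintype.equivFin _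
  haveI := locallyOfFiniteType_hilbertBase iH (Spec (.of ℚ)) (Fintype.card (Option (Fin g ⊕ Fin g)))
  haveI := isClosedImmersion_hilbertBaseFamily_lift iH (Spec (.of ℚ)) (Fintype.card (Option (Fin g ⊕ Fin g)))
  haveI := flat_hilbertBaseFamily_snd iH (Spec (.of ℚ)) (Fintype.card (Option (Fin g ⊕ Fin g)))
  -- R-C2 (A): the produced covariant `𝓗₀ ↪ H₀` with its exports, FROM THE CORES `hII g`, `hF3`, at the explicit terms
  -- Q7: R-C2′ (A′) takes the print-exact dual letter hF3′; it follows from the registry `hF3` on the trivial Zariski cover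
  have hF3' : ∀ ⦃S : Scheme.{0}⦄ [IsLocallyNoetherian S] (_ : S ⟶ Spec (.of ℚ)) (A : AbelianSchemeOver S),
      IsProjective A.X.hom → Nonempty A.DualPair := fun S _ fS A hA =>
    hF3 fS A fun s => ⟨S, 𝟙 S, inferInstance, ⟨s, rfl⟩, A, (Iso.refl A.X).hom.left,
      isBaseChangeVia_id_of_iso_of_one_comp A A (Iso.refl A.X) (Category.comp_id _), hA⟩
  obtain ⟨𝓗₀, jH, hjH, prH, hH, hsq, hemb, hε, hσ, hlft⟩ :=
    exists_siegelFramedCovariant_of_hilbertBase' hN0 hδ hJ he₀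
      (powOver.base (pullback.snd iH (projectiveSpaceMap J (pullback.fst (terminal.from H₁) (terminal.from (Spec (.of ℚ))))) ≫ projectiveSpaceFst J (pullback (terminal.from H₁) (terminal.from (Spec (.of ℚ))))) (Fintype.card (Option (Fin g ⊕ Fin g))) ≫ pullback.snd (terminal.from H₁) (terminal.from (Spec (.of ℚ))))
      (pullback.snd (pullback.snd iH (projectiveSpaceMap J (pullback.fst (terminal.from H₁) (terminal.from (Spec (.of ℚ))))) ≫ projectiveSpaceFst J (pullback (terminal.from H₁) (terminal.from (Spec (.of ℚ))))) (powOver.base (pullback.snd iH (projectiveSpaceMap J (pullback.fst (terminal.from H₁) (terminal.from (Spec (.of ℚ))))) ≫ projectiveSpaceFst J (pullback (terminal.from H₁) (terminal.from (Spec (.of ℚ))))) (Fintype.card (Option (Fin g ⊕ Fin g)))))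
      (pullback.lift (pullback.snd (pullback.snd iH (projectiveSpaceMap J (pullback.fst (terminal.from H₁) (terminal.from (Spec (.of ℚ))))) ≫ projectiveSpaceFst J (pullback (terminal.from H₁) (terminal.from (Spec (.of ℚ))))) (powOver.base (pullback.snd iH (projectiveSpaceMap J (pullback.fst (terminal.from H₁) (terminal.from (Spec (.of ℚ))))) ≫ projectiveSpaceFst J (pullback (terminal.from H₁) (terminal.from (Spec (.of ℚ))))) (Fintype.card (Option (Fin g ⊕ Fin g))))) (pullback.fst (pullback.snd iH (projectiveSpaceMap J (pullback.fst (terminal.from H₁) (terminal.from (Spec (.of ℚ))))) ≫ projectiveSpaceFst J (pullback (terminal.from H₁) (terminal.from (Spec (.of ℚ))))) (powOver.base (pullback.snd iH (projectiveSpaceMap J (pullback.fst (terminal.from H₁) (terminal.from (Spec (.of ℚ))))) ≫ projectiveSpaceFst J (pullback (terminal.from H₁) (terminal.from (Spec (.of ℚ))))) (Fintype.card (Option (Fin g ⊕ Fin g)))) ≫ pullback.snd iH (projectiveSpaceMap J (pullback.fst (terminal.from H₁) (terminal.from (Spec (.of ℚ))))) ≫ pullback.snd (terminal.from (pullback (terminal.from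 H₁) (terminal.from (Spec (.of ℚ))))) (terminal.from (projectiveSpaceInt J))) (terminal.hom_ext _ _))
      (hilbertBaseFamily_lift_comp_fst iH (Spec (.of ℚ)) (Fintype.card (Option (Fin g ⊕ Fin g)))) eι
      (fun k => pullback.lift (WidePullback.π (fun _ : Fin (Fintype.card (Option (Fin g ⊕ Fin g))) => pullback.snd iH (projectiveSpaceMap J (pullback.fst (terminal.from H₁) (terminal.from (Spec (.of ℚ))))) ≫ projectiveSpaceFst J (pullback (terminal.from H₁) (terminal.from (Spec (.of ℚ))))) k) (𝟙 (powOver (pullback.snd iH (projectiveSpaceMap J (pullback.fst (terminal.from H₁) (terminal.from (Spec (.of ℚ))))) ≫ projectiveSpaceFst J (pullback (terminal.from H₁) (terminal.from (Spec (.of ℚ))))) (Fintype.card (Option (Fin g ⊕ Fin g))))) (by rw [WidePullback.π_arrow, Category.id_comp]))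
      (fun k => lift_π_id_comp_snd (pullback.snd iH (projectiveSpaceMap J (pullback.fst (terminal.from H₁) (terminal.from (Spec (.of ℚ))))) ≫ projectiveSpaceFst J (pullback (terminal.from H₁) (terminal.from (Spec (.of ℚ))))) (Fin (Fintype.card (Option (Fin g ⊕ Fin g)))) k)
      (hilbertBase_with_sections_explicit
        (fun T X (i : X ⟶ projectiveSpace J T) => ∀ e, e₀ ≤ e →
        HasRank ((Scheme.Modules.pushforward (i ≫ projectiveSpaceFst J T)).obj
          (SerreTwist.twistMod (i ≫ pullback.snd (terminal.from T) (terminal.from (projectiveSpaceInt J))) (unitModule X) e))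
          ((6 * e) ^ g * polarizationDegree δ))
        iH huniv (Spec (.of ℚ)) (Fintype.card (Option (Fin g ⊕ Fin g))))
      (hII g) hF3'
  haveI := hjH
  haveI := 𝓗₀.isLocallyNoetherian
  -- P3 at the universal rigidification `(𝓗₀.univ, 𝓗₀.emb)`, graph datum `Gr = (1, λ)`
  let Gr : 𝓗₀.univ.A.X.left ⟶ 𝓗₀.univ.A.prodLeft 𝓗₀.univ.D.hat :=
    pullback.lift (𝟙 _) 𝓗₀.univ.pol.lam.left (by rw [Category.id_comp, Over.w])
  have hGr₁ : Gr ≫ pullback.fst 𝓗₀.univ.A.X.hom 𝓗₀.univ.D.hat.X.hom = 𝟙 _ := pullback.lift_fst _ _ _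
  have hGr₂ : Gr ≫ pullback.snd 𝓗₀.univ.A.X.hom 𝓗₀.univ.D.hat.X.hom = 𝓗₀.univ.pol.lam.left := pullback.lift_snd _ _ _
  obtain ⟨hc2, hc3⟩ := stub_PLunitCocycle 𝓗₀.H.hom 𝓗₀.univ 𝓗₀.emb 𝓗₀.isLinearRigidification_emb hJ Gr hGr₁ hGr₂
  -- P4 (assembly) for `𝓗₀`, then P0 transports `PL` to the given `𝓗`
  exact SiegelFramedCovariant.pl_of_exists_pl
    ⟨𝓗₀, stub_PLofHilbertBase hg hδ hN0 hJ d k e₀ he₀ h1d hreg j iH hrank hQ hP hQP huniv eι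
      𝓗₀ jH prH hH hsq hemb hε hσ hlft Gr hGr₁ hGr₂ hc2 hc3⟩ 𝓗

end Summit.HodgeConjecture.CorCM.Cruxes.HypDel.F13PluckerProducer

end
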